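import Mathlib.MeasureTheory.Measure.Lebesgue.Complex
import Mathlib.MeasureTheory.Measure.Haar.InnerProductSpace
import Mathlib.MeasureTheory.Group.Measure
import Mathlib.Analysis.Complex.Isometry
import Mathlib.Analysis.SpecialFunctions.Complex.Circle
import Literature.Analysis.FunctionSpaces.PoissonPointProcess

/-!
# Poisson processes: the Mapping Theorem for a partial rotation of the plane

Helper file for the crux `QuadrupoleSelectionRule` (stmt-CriticalPhenomena-7029, informal) of route
`CardyFlipRusso` (sub-problem `CardyFormulaZ2`), line `Sketch`, stub S4 of the lead's skeleton.

Card A (`average-first-odd-sector-gap`) of the crux spends the isotropy of the environment law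
LOCALLY: rotate the configuration inside a disc `B(z,r)` by an angle `θ` about `z` and keep the
outside.  For the Poisson hub of the route this "partial rotation" preserves the law.  This file
proves the Mapping-Theorem half of that statement:

* `isPoissonPointProcess_map_of_count_preimage` — generic Mapping Theorem through counts: if a
  measurable configuration map `Φ` pulls counts back along a measurable map `g` of the ground
  space (`N_{Φ c}(s) = N_c(g⁻¹ s)`), then `Φ` sends a Poisson process of intensity `ν` to a Poisson
  process of intensity `ν.map g` (Kingman 1993, §2.3, (2.24)–(2.26), injective case);
* the piecewise map "rotate by `θ` about `z` inside the open disc `B(z,r)`, identity outside"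
  (written as an explicit lambda, no new definition): `measurable_partialRotation` and
  `measurePreserving_partialRotation` — it preserves Lebesgue measure on `ℂ`
  (`measurePreserving_rotateAbout`: the full rotation does, being translation ∘ linear isometry ∘
  translation; the disc is invariant, `rotateAbout_preimage_ball`);
* `isPoissonPointProcess_map_partialRotation` — stub S4: a configuration map whose counts are the
  pull-back counts along the partial rotation maps a Poisson process of Lebesgue intensity to a
  Poisson process of Lebesgue intensity.  (With `IsPoissonPointProcess.unique_holds` this gives
  the invariance `P.map Φ = P`, the card statement `PoissonPartialRotationInvariance`.)

## References

* J. F. C. Kingman, *Poisson Processes*, OUP (1993), §2.3 Mapping Theorem, (2.24)–(2.26).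
-/

noncomputable section

open MeasureTheory ProbabilityTheory Set Function
open scoped ENNReal NNReal

namespace Summit.CriticalPhenomena.CardyFormulaZ2.Theorems

open Literature.Analysis.FunctionSpaces

/-! ### A generic Mapping Theorem through the counting maps -/

/-- Independence transports along a measurable change of variables: if the `g i ∘ T` are
independent under `μ`, the `g i` are independent under `μ.map T`. [folklore] -/
private theorem iIndepFun_map_of_comp {Ω Ω' ι : Type*} [MeasurableSpace Ω] [MeasurableSpace Ω']
    {β : ι → Type*} [∀ i, MeasurableSpace (β i)] {μ : Measure Ω} {T : Ω → Ω'}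
    (hT : Measurable T) {g : ∀ i, Ω' → β i} (hg : ∀ i, Measurable (g i))
    (h : iIndepFun (fun i => g i ∘ T) μ) : iIndepFun g (μ.map T) := by
  rw [iIndepFun_iff_measure_inter_preimage_eq_mul] at h ⊢
  intro S sets hsets
  have hmeas : ∀ i ∈ S, MeasurableSet (g i ⁻¹' sets i) := fun i hi => hg i (hsets i hi)
  have h1 : ∀ i ∈ S, μ.map T (g i ⁻¹' sets i) = μ ((g i ∘ T) ⁻¹' sets i) := fun i hi => by
    rw [Measure.map_apply hT (hmeas i hi), Set.preimage_comp]
  rw [Finset.prod_congr rfl h1, Measure.map_apply hT (Finset.measurableSet_biInter S hmeas),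
    Set.preimage_iInter₂]
  simpa only [Set.preimage_comp] using h S hsets

/-- **Mapping Theorem through counts** (Kingman 1993, §2.3, (2.24)–(2.26), the injective case):
if a measurable map `Φ` of configurations has counts `N_{Φ c}(s) = N_c(g⁻¹ s)` for a measurable map
`g` of the ground space, then `Φ` maps a Poisson point process of intensity `ν` to a Poisson point
process of intensity `ν.map g`: the image counts are Poisson of mean `ν (g⁻¹ s)` and disjoint sets
have disjoint preimages. [folklore] -/
theorem isPoissonPointProcess_map_of_count_preimage {E : Type*} [TopologicalSpace E]
    [MeasurableSpace E] {ν : Measure E} {P : Measure (PointConfig E)}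
    (hP : IsPoissonPointProcess ν P) {Φ : PointConfig E → PointConfig E} (hΦ : Measurable Φ)
    {g : E → E} (hg : Measurable g)
    (hcount : ∀ (c : PointConfig E) (s : Set E), MeasurableSet s →
      (Φ c).count s = c.count (g ⁻¹' s)) :
    IsPoissonPointProcess (ν.map g) (P.map Φ) := by
  haveI := hP.isProbabilityMeasure
  refine ⟨Measure.isProbabilityMeasure_map hΦ.aemeasurable, fun s hs hfin => ?_,
    fun n s hs hd => ?_⟩
  · rw [Measure.map_apply hg hs] at hfin ⊢
    have hcomp : (fun c : PointConfig E => c.count s) ∘ Φ =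
        fun c : PointConfig E => c.count (g ⁻¹' s) :=
      funext fun c => hcount c s hs
    rw [Measure.map_map (PointConfig.measurable_count hs) hΦ, hcomp]
    exact hP.map_count (hg hs) hfin
  · refine iIndepFun_map_of_comp hΦ (fun i => PointConfig.measurable_count (hs i)) ?_
    have hcomp : (fun i => (fun c : PointConfig E => c.count (s i)) ∘ Φ)
        = fun i (c : PointConfig E) => c.count (g ⁻¹' s i) := by
      funext i c
      exact hcount c (s i) (hs i)
    rw [hcomp]
    exact hP.iIndepFun_count (fun i => hg (hs i)) fun i j hij => (hd hij).preimage g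

/-! ### The partial rotation of the plane -/

/-- The rotation of `ℂ` by the angle `θ` about the centre `z`, `w ↦ z + e^{iθ} (w - z)`, is
continuous. [folklore] -/
theorem continuous_rotateAbout (z : ℂ) (θ : ℝ) :
    Continuous (fun w : ℂ => z + Complex.exp ((θ : ℂ) * Complex.I) * (w - z)) := by
  fun_prop

/-- The rotation about `z` preserves the distance to `z`. [folklore] -/
theorem dist_rotateAbout (z : ℂ) (θ : ℝ) (w : ℂ) :
    dist (z + Complex.exp ((θ : ℂ) * Complex.I) * (w - z)) z = dist w z := by
  rw [Complex.dist_eq, Complex.dist_eq, add_sub_cancel_left, norm_mul,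
    Complex.norm_exp_ofReal_mul_I, one_mul]

/-- The rotation about `z` maps the disc `B(z,r)` onto itself (as a preimage statement). [folklore] -/
theorem rotateAbout_preimage_ball (z : ℂ) (r θ : ℝ) :
    (fun w : ℂ => z + Complex.exp ((θ : ℂ) * Complex.I) * (w - z)) ⁻¹' Metric.ball z r
      = Metric.ball z r := by
  ext w
  simp only [Set.mem_preimage, Metric.mem_ball, dist_rotateAbout]

/-- The rotation about `z` preserves Lebesgue measure on `ℂ`: it is the composite of the
translation by `-z`, the linear isometry `w ↦ e^{iθ} w` and the translation by `z`. [folklore] -/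
theorem measurePreserving_rotateAbout (z : ℂ) (θ : ℝ) :
    MeasurePreserving (fun w : ℂ => z + Complex.exp ((θ : ℂ) * Complex.I) * (w - z))
      (volume : Measure ℂ) volume := by
  have h1 : MeasurePreserving (fun w : ℂ => w - z) (volume : Measure ℂ) volume :=
    measurePreserving_sub_right volume z
  have h2 : MeasurePreserving (fun w : ℂ => (rotation (Circle.exp θ) : ℂ → ℂ) w)
      (volume : Measure ℂ) volume :=
    (rotation (Circle.exp θ)).measurePreserving
  have h3 : MeasurePreserving (fun w : ℂ => z + w) (volume : Measure ℂ) volume :=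
    measurePreserving_add_left volume z
  have hcomp : (fun w : ℂ => z + Complex.exp ((θ : ℂ) * Complex.I) * (w - z)) =
      (fun w : ℂ => z + w) ∘ (fun w : ℂ => (rotation (Circle.exp θ) : ℂ → ℂ) w) ∘
        (fun w : ℂ => w - z) := by
    funext w
    simp only [Function.comp_apply, rotation_apply, Circle.coe_exp]
  rw [hcomp]
  exact h3.comp (h2.comp h1)

/-- Preimages under the partial rotation "rotate by `θ` about `z` inside the open disc `B(z,r)`,
fix the outside": inside the disc the preimage under the rotation about `z`, outside the set
itself. [folklore] -/
theorem partialRotation_preimage (z : ℂ) (r θ : ℝ) (s : Set ℂ) :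
    (fun w : ℂ => if dist w z < r then z + Complex.exp ((θ : ℂ) * Complex.I) * (w - z) else w) ⁻¹' s
      = ((fun w : ℂ => z + Complex.exp ((θ : ℂ) * Complex.I) * (w - z)) ⁻¹' s ∩ Metric.ball z r)
        ∪ (s \ Metric.ball z r) := by
  ext w
  simp only [Set.mem_preimage, Set.mem_union, Set.mem_inter_iff, Set.mem_sdiff, Metric.mem_ball]
  by_cases hw : dist w z < r
  · rw [if_pos hw]
    tauto
  · rw [if_neg hw]
    tauto

/-- The partial rotation is measurable. [folklore] -/
theorem measurable_partialRotation (z : ℂ) (r θ : ℝ) :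
    Measurable (fun w : ℂ => if dist w z < r then
      z + Complex.exp ((θ : ℂ) * Complex.I) * (w - z) else w) := by
  have hset : MeasurableSet {w : ℂ | dist w z < r} :=
    measurableSet_lt (continuous_id.dist continuous_const).measurable measurable_const
  exact Measurable.ite hset (continuous_rotateAbout z θ).measurable measurable_id

/-- **The partial rotation preserves Lebesgue measure on `ℂ`**: inside the disc it is an isometry
of the disc onto itself, outside it is the identity. [folklore] -/
theorem measurePreserving_partialRotation (z : ℂ) (r θ : ℝ) :
    MeasurePreserving (fun w : ℂ => if dist w z < r then
      z + Complex.exp ((θ : ℂ) * Complex.I) * (w - z) else w) (volume : Measure ℂ) volume := by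
  refine ⟨measurable_partialRotation z r θ, Measure.ext fun s hs => ?_⟩
  have hB : MeasurableSet (Metric.ball z r) := Metric.isOpen_ball.measurableSet
  have hρ := measurePreserving_rotateAbout z θ
  rw [Measure.map_apply (measurable_partialRotation z r θ) hs, partialRotation_preimage]
  have hdisj : Disjoint
      ((fun w : ℂ => z + Complex.exp ((θ : ℂ) * Complex.I) * (w - z)) ⁻¹' s ∩ Metric.ball z r)
      (s \ Metric.ball z r) :=
    Set.disjoint_left.2 fun w hw hw' => hw'.2 hw.2
  rw [measure_union hdisj (hs.diff hB)]
  have h1 : volume ((fun w : ℂ => z + Complex.exp ((θ : ℂ) * Complex.I) * (w - z)) ⁻¹' s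
      ∩ Metric.ball z r) = volume (s ∩ Metric.ball z r) := by
    rw [← rotateAbout_preimage_ball z r θ, ← Set.preimage_inter, rotateAbout_preimage_ball]
    exact hρ.measure_preimage (hs.inter hB).nullMeasurableSet
  rw [h1, measure_inter_add_sdiff _ hB]

/-! ### Stub S4: the Mapping Theorem for the partial rotation -/

/-- **Stub S4 of line `Sketch` (crux stmt-CriticalPhenomena-7029, card A
`average-first-odd-sector-gap`).** A measurable map `Φ` of configurations whose counts are the
pull-back counts along the partial rotation "rotate inside `B(z,r)` by `θ` about `z`, keep the
outside" maps a Poisson point process of Lebesgue intensity on `ℂ` to a Poisson point process of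
Lebesgue intensity (Mapping Theorem, the partial rotation preserving Lebesgue measure).  Combined
with Rényi–Kingman uniqueness (`IsPoissonPointProcess.unique_holds`) this is the exact
partial-rotation symmetry `P.map Φ = P` of the Poisson hub. [folklore] -/
theorem isPoissonPointProcess_map_partialRotation
    (P : Measure (PointConfig ℂ)) (z : ℂ) (r θ : ℝ) (Φ : PointConfig ℂ → PointConfig ℂ)
    (hP : IsPoissonPointProcess (volume : Measure ℂ) P) (hΦ : Measurable Φ)
    (hcount : ∀ (c : PointConfig ℂ) (s : Set ℂ), MeasurableSet s →
      (Φ c).count s = c.count ((fun w : ℂ => if dist w z < r then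
        z + Complex.exp ((θ : ℂ) * Complex.I) * (w - z) else w) ⁻¹' s)) :
    IsPoissonPointProcess (volume : Measure ℂ) (P.map Φ) := by
  have h := isPoissonPointProcess_map_of_count_preimage hP hΦ
    (measurable_partialRotation z r θ) hcount
  rwa [(measurePreserving_partialRotation z r θ).map_eq] at h

end Summit.CriticalPhenomena.CardyFormulaZ2.Theorems

end
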